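import Summits.NavierStokesRegularity.NavierStokesRegularity.Theorems.StrainDoorsTypeITangentTwist
import Summits.NavierStokesRegularity.NavierStokesRegularity.Theorems.StrainDoorsNearRecordLaw
import HarnessLib

/-!
# StrainDoorsTypeITangentTwistLaws — PART M §M5: THE NEAR-RECORD TWIST LAWS ON `u` ITSELF

nsreg-p1 g36, ROUND-62 (helper lane of `stmt-NavierStokesRegularity-0056`, rung N0; 0 ledger writes by the
planner; tree file 2 of 2 of ROUND-62, imports §M4 `StrainDoorsTypeITangentTwist` and PART L §L3
`StrainDoorsNearRecordLaw` (for `eq_zero_of_typeI_of_curl_eq_zero`); bodies farm-certified inside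
`r62/StrainDoorsR62All.lean`, rc 0 · 0 warn · 0 sorry, 9/9 std axioms).

Laws ON THE ORIGINAL SOLUTION, uniform in the Type-I class `{classical on (−∞,0) × ℝ³, ν = 1, f = 0,
|u(t,x)| ≤ C₀/(|x| + √(−t))}`, with NO limit object in the statements (contradiction + §M4 + the record identity /
peak inequality of PART J/K at the extracted peak):

* ★★★ `typeI_nearRecord_reduced_stretching` — `∀ C₀ w₀ ε ∃ δ`: at every point where the scale-invariant vorticity
  comes within `δ` of an upper bound `W ≥ w₀` of the vorticity number, `1 − ε ≤ (0 − t)(⟪ξ, ∇u ξ⟫ − |∇ξ|²_F)`: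
  the vorticity record law `1 ≤ (T − t)(α − ν|∇ξ|²_F)` (exact records, `vorticity_record_law`) transported to ALL
  near-record points; strictly stronger than PART L's floor `(0 − t)α ≥ 1 − ε`;
* ★★ `typeI_nearRecord_twist_pinch` — `∃ K₃(C₀) ∀ w₀ ε ∃ δ`: `(0 − t)|∇ξ|²_F ≤ K₃/w₀ + ε` near records:
  Constantin–Fefferman coherence of the direction field, `|∇ξ| ≲ 1/√(T − t)`, holds AUTOMATICALLY near the
  vorticity-number records of a Type-I flow, with a constant LINEAR in `1/w₀` (peak inequality
  `ρ̄|∇ξ̄|²_F ≤ −⟪ξ̄, Δω̄⟫ ≤ K₃`; derivative bounds alone give `∝ 1/w₀²`);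
* ★★ `typeI_exists_nearCritical_reduced_stretching` — every non-trivial Type-I ancient solution has, for every
  `ε > 0`, a point with `ω ≠ 0` and `(0 − t)(⟪ξ,∇u ξ⟫ − |∇ξ|²_F) ≥ 1 − ε`;
* ★★★ `eq_zero_of_typeI_of_reduced_stretching_le` — LIOUVILLE under a uniform REDUCED-stretching cap
  `(0 − t)(⟪ξ,∇u ξ⟫ − |∇ξ|²_F) ≤ 1 − ε` wherever `ω ≠ 0`: implied by PART L's stretching cap and, independently,
  by a TWIST FLOOR `(0 − t)|∇ξ|²_F ≥ (0 − t)⟪ξ,∇u ξ⟫ − 1 + ε` — enough incoherence of the vorticity direction at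
  the parabolic scale kills a Type-I ancient solution (geometric depletion as a Liouville HYPOTHESIS, pointwise,
  no integral norm);
* ★★★ `eq_zero_of_typeI_of_nearRecord_reduced_stretching_cap` — the same with the cap on the near-record set only.

WHAT THIS IS NOT: no blow-up or profile is excluded unconditionally; `0056` / `10661` / NS regularity are NOT
proved; the peak doors of PART K (`PeakConcavityFloor`, `PeakTwistFloor`, `PeakStretchingCap`, `PeakClassEmpty`)
stay OPEN; every unconditional statement is a NECESSARY condition near records, the Liouville theorems carry an
explicit hypothesis.  No new definitions; no sorry.
[cite: ConstantinFefferman1993, §1; KochNadirashviliSereginSverak2009, (4.11), Lemma 6.1;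
GalantiGibbonHeritage1997, §3 (Dw1)–(Dw4); BealeKatoMajda1984, §1]
-/

noncomputable section

open MeasureTheory Set Function Filter Metric Real InnerProductSpace
open _root_.Topology
open scoped ENNReal NNReal RealInnerProductSpace ContDiff Laplacian
open Literature.Analysis Literature.Analysis.FluidPDE
open Literature.Analysis.FluidPDE.VorticityDirectionDynamics

set_option linter.dupNamespace false

namespace Summit.NavierStokesRegularity.NavierStokesRegularity.Theorems.StrainDoors

open Summit.NavierStokesRegularity.NavierStokesRegularity.Theorems.ArgmaxDoors

/-! ## §M5 The near-record twist laws on `u` itself -/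

/-- ★★★ **THE NEAR-RECORD REDUCED-STRETCHING FLOOR ON `u` ITSELF.**  For all `C₀`, `w₀ > 0`, `ε > 0` there is
`δ > 0` such that: for every classical solution `(u,p)` of Navier–Stokes (`ν = 1`, `f = 0`) on `(−∞,0) × ℝ³` with
`|u(t,x)| ≤ C₀/(|x| + √(−t))`, every upper bound `W ≥ w₀` of its vorticity number and every space-time point `(t,x)`
with `(0 − t)|ω(t,x)| ≥ W − δ`, the stretching rate REDUCED BY THE VISCOUS TWIST still beats the clock:
`(0 − t)·(⟪ξ, ∇u ξ⟫ − |∇ξ|²_F)(t,x) ≥ 1 − ε`.  This is the vorticity record law `1 ≤ (T − t)(α − ν|∇ξ|²_F)` of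
`vorticity_record_law` (exact records only) transported to ALL near-record points, uniformly in the Type-I class
(contradiction + §M4 + the record identity `(0 − (−1))(ᾱ − F̄) = 1 + (0 − (−1))(−Δ|ω̄|)(z̄)/ρ̄ ≥ 1` at the extracted
peak).  Strictly stronger than PART L's floor `(0 − t)α ≥ 1 − ε`. [new-as-typed] -/
theorem typeI_nearRecord_reduced_stretching (C₀ w₀ ε : ℝ) (hw₀ : 0 < w₀) (hε : 0 < ε) :
    ∃ δ : ℝ, 0 < δ ∧
      ∀ (u : ℝ → (EuclideanSpace ℝ (Fin 3)) → (EuclideanSpace ℝ (Fin 3))) (p : ℝ → (EuclideanSpace ℝ (Fin 3)) → ℝ)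
        (W t : ℝ) (x : EuclideanSpace ℝ (Fin 3)),
        IsClassicalNSSolutionOn (Iio 0) 1 0 u p → HasTypeIDecay C₀ u →
        (∀ s : ℝ, s < 0 → ∀ y, (0 - s) * ‖curl (u s) y‖ ≤ W) → w₀ ≤ W → t < 0 →
        W - δ ≤ (0 - t) * ‖curl (u t) x‖ →
        1 - ε ≤ (0 - t) * (⟪vorticityDirection (curl (u t)) x,
          fderiv ℝ (u t) x (vorticityDirection (curl (u t)) x)⟫ -
          frobeniusNormSq (fderiv ℝ (vorticityDirection (curl (u t))) x)) := by
  by_contra H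
  push Not at H
  have Hj := fun j : ℕ => H (w₀ / ((j : ℝ) + 2)) (by positivity)
  choose u p W t x hsol hI hdom hW ht hnear hbad using Hj
  have hδ1 : ∀ j : ℕ, w₀ / ((j : ℝ) + 2) ≤ w₀ / 2 := fun j =>
    div_le_div_of_nonneg_left hw₀.le (by norm_num) (by linarith [(Nat.cast_nonneg j : (0:ℝ) ≤ j)])
  have hδ : Tendsto (fun j : ℕ => w₀ / ((j : ℝ) + 2)) atTop (𝓝 0) :=
    tendsto_const_nhds.div_atTop (tendsto_atTop_add_const_right _ _ tendsto_natCast_atTop_atTop)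
  obtain ⟨v, zbar, hP, hw, θ, hθ, hconv, hconvT⟩ :=
    typeI_nearRecord_extraction₂ hw₀ hsol hI hdom hW ht hnear hδ1 hδ
  -- the record identity at the extracted peak: `(0 − (−1))(ᾱ − F̄) = 1 + (−L)/ρ̄ ≥ 1`
  obtain ⟨-, -, hlap, hid, -, -⟩ := hP.record_identity
  have hρ : 0 < ‖curl (v (-1)) zbar‖ := by linarith
  have hq : 0 ≤ (0 - (-1)) * (-(Δ fun y => ‖curl (v (-1)) y‖) zbar) / ‖curl (v (-1)) zbar‖ :=
    div_nonneg (by linarith [hlap]) hρ.le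
  have hlaw : 1 ≤ (0 - (-1)) * ⟪vorticityDirection (curl (v (-1))) zbar,
      fderiv ℝ (v (-1)) zbar (vorticityDirection (curl (v (-1))) zbar)⟫ -
      (0 - (-1)) * frobeniusNormSq (fderiv ℝ (vorticityDirection (curl (v (-1)))) zbar) := by
    rw [← mul_sub]; linarith [hid, hq]
  -- but along the bad points the reduced rates stay below `1 - ε`
  have hle := le_of_tendsto' (hconv.sub hconvT) fun j => by
    have h := hbad (θ j)
    rw [mul_sub] at h
    exact h.le
  linarith

/-- ★★ **THE NEAR-RECORD TWIST PINCH ON `u` ITSELF.**  With the uniform Laplacian constant `K₃(C₀)` of PART J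
(`tangent_laplacian_curl_bound`, KNSS (4.11) on tangent fields): for all `w₀ > 0`, `ε > 0` there is `δ > 0` such
that at every space-time point of every classical Type-I solution (constant `C₀`) where the scale-invariant vorticity
comes within `δ` of an upper bound `W ≥ w₀` of the vorticity number, the scale-invariant TWIST of the vorticity
direction is pinched: `(0 − t)·|∇ξ|²_F(t,x) ≤ K₃(C₀)/w₀ + ε`.  In words: Constantin–Fefferman coherence of the
direction field, `|∇ξ| ≤ C/√(T − t)`, holds AUTOMATICALLY near the vorticity-number records of a Type-I flow, with a
constant LINEAR in `1/w₀` (the peak inequality `ρ̄|∇ξ̄|²_F ≤ −⟪ξ̄, Δω̄⟫ ≤ K₃`; derivative bounds alone give only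
`∝ 1/w₀²`). [new-as-typed] -/
theorem typeI_nearRecord_twist_pinch (C₀ : ℝ) : ∃ K₃ : ℝ, 0 ≤ K₃ ∧ ∀ (w₀ ε : ℝ), 0 < w₀ → 0 < ε →
    ∃ δ : ℝ, 0 < δ ∧
      ∀ (u : ℝ → (EuclideanSpace ℝ (Fin 3)) → (EuclideanSpace ℝ (Fin 3))) (p : ℝ → (EuclideanSpace ℝ (Fin 3)) → ℝ)
        (W t : ℝ) (x : EuclideanSpace ℝ (Fin 3)),
        IsClassicalNSSolutionOn (Iio 0) 1 0 u p → HasTypeIDecay C₀ u →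
        (∀ s : ℝ, s < 0 → ∀ y, (0 - s) * ‖curl (u s) y‖ ≤ W) → w₀ ≤ W → t < 0 →
        W - δ ≤ (0 - t) * ‖curl (u t) x‖ →
        (0 - t) * frobeniusNormSq (fderiv ℝ (vorticityDirection (curl (u t))) x) ≤ K₃ / w₀ + ε := by
  obtain ⟨K₃, hK₃, hK⟩ := tangent_laplacian_curl_bound C₀
  refine ⟨K₃, hK₃, fun w₀ ε hw₀ hε => ?_⟩
  by_contra H
  push Not at H
  have Hj := fun j : ℕ => H (w₀ / ((j : ℝ) + 2)) (by positivity)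
  choose u p W t x hsol hI hdom hW ht hnear hbad using Hj
  have hδ1 : ∀ j : ℕ, w₀ / ((j : ℝ) + 2) ≤ w₀ / 2 := fun j =>
    div_le_div_of_nonneg_left hw₀.le (by norm_num) (by linarith [(Nat.cast_nonneg j : (0:ℝ) ≤ j)])
  have hδ : Tendsto (fun j : ℕ => w₀ / ((j : ℝ) + 2)) atTop (𝓝 0) :=
    tendsto_const_nhds.div_atTop (tendsto_atTop_add_const_right _ _ tendsto_natCast_atTop_atTop)
  obtain ⟨v, zbar, hP, hw, θ, hθ, -, hconvT⟩ :=
    typeI_nearRecord_extraction₂ hw₀ hsol hI hdom hW ht hnear hδ1 hδ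
  -- the peak inequality `ρ̄ F̄ ≤ −⟪ξ̄, Δω̄⟫ ≤ K₃` and `ρ̄ ≥ w₀`
  obtain ⟨-, -, -, -, -, hii⟩ := hP.record_identity
  obtain ⟨hvc, hvI, hweak, hne, -⟩ := hP
  have hΔ : ‖(Δ (curl (v (-1)))) zbar‖ ≤ K₃ := hK hvc hvI hweak (-1) (by norm_num) zbar
  have hξ : ‖vorticityDirection (curl (v (-1))) zbar‖ = 1 := norm_vorticityDirection _ hne
  have hcs : -⟪vorticityDirection (curl (v (-1))) zbar, (Δ (curl (v (-1)))) zbar⟫ ≤ K₃ := by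
    have h := abs_real_inner_le_norm (vorticityDirection (curl (v (-1))) zbar) ((Δ (curl (v (-1)))) zbar)
    rw [hξ, one_mul] at h
    linarith [(abs_le.mp h).1, hΔ]
  have hF0 := frobeniusNormSq_nonneg (fderiv ℝ (vorticityDirection (curl (v (-1)))) zbar)
  have h1 : w₀ * frobeniusNormSq (fderiv ℝ (vorticityDirection (curl (v (-1)))) zbar) ≤
      ‖curl (v (-1)) zbar‖ * frobeniusNormSq (fderiv ℝ (vorticityDirection (curl (v (-1)))) zbar) :=
    mul_le_mul_of_nonneg_right hw hF0
  have hup : (0 - (-1)) * frobeniusNormSq (fderiv ℝ (vorticityDirection (curl (v (-1)))) zbar) ≤ K₃ / w₀ := by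
    rw [show (0 - (-1) : ℝ) = 1 by norm_num, one_mul, le_div_iff₀ hw₀]
    linarith [h1, hii, hcs]
  -- but along the bad points the twists stay above `K₃/w₀ + ε`
  have hge := ge_of_tendsto' hconvT fun j => (hbad (θ j)).le
  linarith

/-- ★★ **EVERY NON-TRIVIAL TYPE-I ANCIENT SOLUTION HAS POINTS OF NEAR-CRITICAL REDUCED STRETCHING.**  If `(u,p)`
is a classical Type-I solution on `(−∞,0) × ℝ³` with `ω ≢ 0`, then for every `ε > 0` there is a space-time point
`(t,x)`, `t < 0`, with `ω(t,x) ≠ 0` and `(0 − t)·(⟪ξ, ∇u ξ⟫ − |∇ξ|²_F)(t,x) ≥ 1 − ε` (the reduced floor at a point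
where the vorticity number `N = sup (0 − s)|ω|` is `δ`-approached). [new-as-typed] -/
theorem typeI_exists_nearCritical_reduced_stretching {C₀ : ℝ}
    {u : ℝ → (EuclideanSpace ℝ (Fin 3)) → (EuclideanSpace ℝ (Fin 3))} {p : ℝ → (EuclideanSpace ℝ (Fin 3)) → ℝ}
    (hsol : IsClassicalNSSolutionOn (Iio 0) 1 0 u p) (hI : HasTypeIDecay C₀ u)
    (hcurl : ∃ t₀ : ℝ, t₀ < 0 ∧ ∃ x₀, curl (u t₀) x₀ ≠ 0) {ε : ℝ} (hε : 0 < ε) :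
    ∃ t : ℝ, t < 0 ∧ ∃ x : EuclideanSpace ℝ (Fin 3), curl (u t) x ≠ 0 ∧
      1 - ε ≤ (0 - t) * (⟪vorticityDirection (curl (u t)) x,
        fderiv ℝ (u t) x (vorticityDirection (curl (u t)) x)⟫ -
        frobeniusNormSq (fderiv ℝ (vorticityDirection (curl (u t))) x)) := by
  have hC₀ : 0 ≤ C₀ := HasTypeIDecay.nonneg' hI
  obtain ⟨t₀, ht₀, x₀, hx₀⟩ := hcurl
  obtain ⟨B, hB, hBb⟩ := typeI_vorticityNumber_bound hC₀
  -- the vorticity number `N = sup (0 - s)|ω(s,y)|`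
  obtain ⟨S, hS⟩ : ∃ S : Set ℝ, S = {r | ∃ s : ℝ, s < 0 ∧ ∃ y : EuclideanSpace ℝ (Fin 3),
      r = (0 - s) * ‖curl (u s) y‖} := ⟨_, rfl⟩
  have hbdd : BddAbove S := ⟨B, fun r hr => by
    rw [hS] at hr; obtain ⟨s, hs, y, rfl⟩ := hr; exact hBb hsol hI s hs y⟩
  have hmem : ∀ s : ℝ, s < 0 → ∀ y, (0 - s) * ‖curl (u s) y‖ ∈ S := fun s hs y => by
    rw [hS]; exact ⟨s, hs, y, rfl⟩
  have hN0 : 0 < sSup S := by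
    have h1 : 0 < (0 - t₀) * ‖curl (u t₀) x₀‖ := mul_pos (by linarith) (norm_pos_iff.mpr hx₀)
    exact h1.trans_le (le_csSup hbdd (hmem t₀ ht₀ x₀))
  have hdom : ∀ s : ℝ, s < 0 → ∀ y, (0 - s) * ‖curl (u s) y‖ ≤ sSup S := fun s hs y =>
    le_csSup hbdd (hmem s hs y)
  obtain ⟨δ, hδ, hlaw⟩ := typeI_nearRecord_reduced_stretching C₀ (sSup S) ε hN0 hε
  -- a point where the sup is approached within `min δ (N/2)`
  have hlt : sSup S - min δ (sSup S / 2) < sSup S := by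
    have := lt_min hδ (half_pos hN0); linarith
  obtain ⟨r, hr, hrlt⟩ := exists_lt_of_lt_csSup ⟨_, hmem t₀ ht₀ x₀⟩ hlt
  rw [hS] at hr
  obtain ⟨t, ht, x, rfl⟩ := hr
  refine ⟨t, ht, x, ?_, hlaw u p (sSup S) t x hsol hI hdom le_rfl ht ?_⟩
  · intro h0
    rw [h0, norm_zero, mul_zero] at hrlt
    have := min_le_right δ (sSup S / 2); linarith
  · have := min_le_left δ (sSup S / 2); linarith

/-- ★★★ **LIOUVILLE UNDER A UNIFORM REDUCED-STRETCHING CAP: GEOMETRIC DEPLETION AS A LIOUVILLE HYPOTHESIS.**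
A classical Type-I solution on `(−∞,0) × ℝ³` whose scale-invariant stretching rate REDUCED BY THE TWIST stays
uniformly subcritical wherever the vorticity is non-zero, `(0 − t)·(⟪ξ, ∇u ξ⟫ − |∇ξ|²_F)(t,x) ≤ 1 − ε` (`ε > 0`
fixed), VANISHES IDENTICALLY.  The hypothesis is implied by PART L's stretching cap `(0 − t)⟪ξ,∇u ξ⟫ ≤ 1 − ε` and,
independently, by a TWIST FLOOR `(0 − t)|∇ξ|²_F ≥ (0 − t)⟪ξ,∇u ξ⟫ − 1 + ε`: enough incoherence of the vorticity
direction at the parabolic scale kills a Type-I ancient solution, with no smallness of `|∇ξ|` and no integral norm.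
[new-as-typed] -/
theorem eq_zero_of_typeI_of_reduced_stretching_le {C₀ : ℝ}
    {u : ℝ → (EuclideanSpace ℝ (Fin 3)) → (EuclideanSpace ℝ (Fin 3))} {p : ℝ → (EuclideanSpace ℝ (Fin 3)) → ℝ}
    (hsol : IsClassicalNSSolutionOn (Iio 0) 1 0 u p) (hI : HasTypeIDecay C₀ u) {ε : ℝ} (hε : 0 < ε)
    (hcap : ∀ t : ℝ, t < 0 → ∀ x : EuclideanSpace ℝ (Fin 3), curl (u t) x ≠ 0 →
      (0 - t) * (⟪vorticityDirection (curl (u t)) x,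
        fderiv ℝ (u t) x (vorticityDirection (curl (u t)) x)⟫ -
        frobeniusNormSq (fderiv ℝ (vorticityDirection (curl (u t))) x)) ≤ 1 - ε) :
    ∀ t : ℝ, t < 0 → ∀ x : EuclideanSpace ℝ (Fin 3), u t x = 0 := by
  refine eq_zero_of_typeI_of_curl_eq_zero hsol hI ?_
  by_contra hne
  push Not at hne
  obtain ⟨t₀, ht₀, x₀, hx₀⟩ := hne
  obtain ⟨t, ht, x, hx, hge⟩ :=
    typeI_exists_nearCritical_reduced_stretching hsol hI ⟨t₀, ht₀, x₀, hx₀⟩ (half_pos hε)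
  have := hcap t ht x hx
  linarith

/-- ★★★ **THE REDUCED DOOR ON `u` ITSELF: A NEAR-RECORD REDUCED-STRETCHING CAP IS THE TYPE-I LIOUVILLE THEOREM.**
Let `(u,p)` be a classical Type-I solution on `(−∞,0) × ℝ³` and `W` a SHARP upper bound of its vorticity number.  If
for some `ε, δ > 0` the reduced rate is capped, `(0 − t)·(⟪ξ, ∇u ξ⟫ − |∇ξ|²_F)(t,x) ≤ 1 − ε`, at every point where
`(0 − t)|ω(t,x)| ≥ W − δ` (ONLY the near-record points), then `u ≡ 0`.  Equivalently: a non-trivial Type-I ancient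
solution has, for every `ε, δ > 0`, near-record points where the stretching beats the clock rate PLUS the twist up
to `ε`: `(0 − t)⟪ξ,∇u ξ⟫ > 1 − ε + (0 − t)|∇ξ|²_F`. [new-as-typed] -/
theorem eq_zero_of_typeI_of_nearRecord_reduced_stretching_cap {C₀ : ℝ}
    {u : ℝ → (EuclideanSpace ℝ (Fin 3)) → (EuclideanSpace ℝ (Fin 3))} {p : ℝ → (EuclideanSpace ℝ (Fin 3)) → ℝ}
    (hsol : IsClassicalNSSolutionOn (Iio 0) 1 0 u p) (hI : HasTypeIDecay C₀ u) {W : ℝ}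
    (hdom : ∀ s : ℝ, s < 0 → ∀ y, (0 - s) * ‖curl (u s) y‖ ≤ W)
    (hsharp : ∀ η : ℝ, 0 < η → ∃ s : ℝ, s < 0 ∧ ∃ y, W - η < (0 - s) * ‖curl (u s) y‖)
    {ε δ : ℝ} (hε : 0 < ε) (hδ : 0 < δ)
    (hcap : ∀ t : ℝ, t < 0 → ∀ x : EuclideanSpace ℝ (Fin 3), W - δ ≤ (0 - t) * ‖curl (u t) x‖ →
      (0 - t) * (⟪vorticityDirection (curl (u t)) x,
        fderiv ℝ (u t) x (vorticityDirection (curl (u t)) x)⟫ -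
        frobeniusNormSq (fderiv ℝ (vorticityDirection (curl (u t))) x)) ≤ 1 - ε) :
    ∀ t : ℝ, t < 0 → ∀ x : EuclideanSpace ℝ (Fin 3), u t x = 0 := by
  refine eq_zero_of_typeI_of_curl_eq_zero hsol hI ?_
  by_contra hne
  push Not at hne
  obtain ⟨t₀, ht₀, x₀, hx₀⟩ := hne
  have hW0 : 0 < W :=
    (mul_pos (by linarith) (norm_pos_iff.mpr hx₀)).trans_le (hdom t₀ ht₀ x₀)
  obtain ⟨δ₀, hδ₀, hlaw⟩ := typeI_nearRecord_reduced_stretching C₀ W (ε / 2) hW0 (half_pos hε)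
  obtain ⟨t, ht, x, hx⟩ := hsharp (min δ δ₀) (lt_min hδ hδ₀)
  have h1 : W - δ ≤ (0 - t) * ‖curl (u t) x‖ := by have := min_le_left δ δ₀; linarith
  have h2 : W - δ₀ ≤ (0 - t) * ‖curl (u t) x‖ := by have := min_le_right δ δ₀; linarith
  have hlo := hlaw u p W t x hsol hI hdom le_rfl ht h2
  have hhi := hcap t ht x h1
  linarith

end Summit.NavierStokesRegularity.NavierStokesRegularity.Theorems.StrainDoors

end
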